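import Literature.Topology.FourManifolds.FlowerFanCollar
import Literature.Topology.FourManifolds.FlowerSectorRetraction
import HarnessLib

/-!
# The melon decomposition of the flower domain: the `g` wedges, their fans and edge rays

Topic `Literature/Topology/FourManifolds`; planar bookkeeping ("brick 5b, planar half") for the
fact seat `provefact-Literature.Topology.FourManifolds.exists-cbed50d78a` (named fact (g′)
`Literature.Topology.FourManifolds.exists_marking_centralSurface_of_gkTrisection`).  The flower
domain `{q_g ≤ c_g}` is cut into the `g` wedges `W_k = rot(ζ^{-k})(wedge)` (`k = 0, …, g-1`,
clockwise, bisector angle `ν_k = -2kπ/g`), whose lifts to the model surface are the melon slices of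
`SurfaceGroupMelon.exists_surfaceGroup_mulEquiv_of_melon`.  This file supplies the planar set
identities that instantiation needs, all in terms of the rotated angle `ang μ` of
`FlowerFanCollar.lean`:

* §1 `ang`: uniqueness (`ang_eq_of_mem`), frame shifts by `2π`, rotations (`ang_rot`), the
  reflection (`ang_refl`);
* §2 `secW g k` — the `k`-th wedge; `secW_zero = wedge`, **`image_rot_inv_wedge`**:
  `rot (ζ^k)⁻¹ '' wedge = secW k`;
* §3 **`iUnion_secW_eq_fanW`**: `⋃_{j ≤ m} secW j = fanW m` (`m + 2 ≤ g`; `fanW_zero = wedge`);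
* §4 the edge rays `rayK k = {pol r ((1-2k)π/g)}` (`rayK 0 = vRay`, `image_rot_inv_vRay`,
  `image_refl_vRay = rayK 1`), `rayK k ⊆ secW k`, `rayK (k+1) ⊆ secW k`;
* §5 the symmetry `σ_m = rot(ζ^{-m}) ∘ refl` of the fan `fanW m` swapping its edges
  (`image_fanSymm_fanW`, `image_fanSymm_vRay = rayK (m+1)`);
* §6 the last slice (`g = n + 2`): `secW (n+1) = fanF 1`, `vRay2 1 = rayK 0 ∪ rayK (n+1)`,
  `rot ζ '' fanF (n+1) = fanW n`, `rot ζ '' vRay2 (n+1) = rayK (n+1) ∪ rayK 0`;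
* §7 how consecutive pieces meet: `fanW (k-1) ∩ secW k ⊆ rayK k` (`1 ≤ k`, `k + 2 ≤ g`) and
  `fanW n ∩ secW (n+1) ⊆ rayK (n+1) ∪ rayK 0`.

Everything is proved; no named facts.

## References

* A. Hatcher, *Algebraic Topology*, CUP (2002), §1.2 (the surface `Σ_g` as a union of handles). [HatcherAT2002]
* D. Gay, R. Kirby, *Trisecting 4-manifolds*, Geom. Topol. 20 (2016), Def. 1, Remark 2. [GayKirby2016]
-/

open scoped Manifold ContDiff Topology InnerProductSpace Real
open Set Function Filter Metric Module Complex

noncomputable section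

namespace Literature.Topology.FourManifolds

/-- Local notation: `𝔼 n` is the model Euclidean space `EuclideanSpace ℝ (Fin n)`. -/
local notation "𝔼 " n:arg => EuclideanSpace ℝ (Fin n)

open PlanarThickening PlanarDouble

namespace FlowerModel

variable {g : ℕ}

/-! ### §1 More on the rotated angle -/

/-- **Uniqueness of the rotated angle**: if the angle of `u ≠ 0` in the frame `μ` lies in the
window of the frame `μ'`, the two angles agree. [folklore] -/
theorem ang_eq_of_mem {μ μ' : ℝ} {u : 𝔼 2} (hu : u ≠ 0) (h : ang μ u - μ' ∈ Ioc (-π) π) :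
    ang μ' u = ang μ u := by
  conv_lhs => rw [← pol_norm_ang μ u]
  exact ang_pol (norm_pos_iff.2 hu) h

/-- Shifting the frame by `2π` shifts the angle by `2π`. [folklore] -/
theorem ang_add_two_pi (μ : ℝ) (u : 𝔼 2) : ang (μ + 2 * π) u = ang μ u + 2 * π := by
  have : Complex.exp (-((μ + 2 * π : ℝ) * I)) = Complex.exp (-(μ * I)) := by
    rw [show -(((μ + 2 * π : ℝ) : ℂ) * I) = -((μ : ℂ) * I) + (-1 : ℤ) * (2 * π * I) by push_cast; ring,
      Complex.exp_add, Complex.exp_int_mul_two_pi_mul_I, mul_one]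
  rw [ang, ang, this]; ring

/-- Shifting the frame by `-2π`. [folklore] -/
theorem ang_sub_two_pi (μ : ℝ) (u : 𝔼 2) : ang (μ - 2 * π) u = ang μ u - 2 * π := by
  have := ang_add_two_pi (μ - 2 * π) u
  rw [sub_add_cancel] at this
  linarith

/-- **Rotations shift the angle** (in the correspondingly rotated frame). [folklore] -/
theorem ang_rot (μ α : ℝ) (u : 𝔼 2) : ang (μ + α) (rot (Circle.exp α) u) = ang μ u + α := by
  have : toC (rot (Circle.exp α) u) * Complex.exp (-((μ + α : ℝ) * I)) = toC u * Complex.exp (-(μ * I)) := by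
    rw [toC_rot, Circle.coe_exp, show -(((μ + α : ℝ) : ℂ) * I) = -((μ : ℂ) * I) + (-(α * I)) by push_cast; ring,
      Complex.exp_add]
    have h : Complex.exp (α * I) * Complex.exp (-(α * I)) = 1 := by rw [← Complex.exp_add]; simp
    calc Complex.exp (α * I) * toC u * (Complex.exp (-(μ * I)) * Complex.exp (-(α * I)))
        = toC u * Complex.exp (-(μ * I)) * (Complex.exp (α * I) * Complex.exp (-(α * I))) := by ring
      _ = toC u * Complex.exp (-(μ * I)) := by rw [h, mul_one]
  rw [ang, ang, this]; ring

/-- **The reflection negates the angle** (off the cut of the frame). [folklore] -/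
theorem ang_refl {μ : ℝ} {u : 𝔼 2} (h : ang μ u ≠ μ + π) : ang (-μ) (refl u) = -ang μ u := by
  have hz : toC (refl u) * Complex.exp (-((-μ : ℝ) * I)) = (starRingEnd ℂ) (toC u * Complex.exp (-(μ * I))) := by
    rw [toC_refl, map_mul, ← Complex.exp_conj]
    congr 2
    simp [Complex.conj_ofReal]
  have harg : Complex.arg (toC u * Complex.exp (-(μ * I))) ≠ π := by
    intro hπ; apply h; rw [ang, hπ, add_comm]
  rw [ang, ang, hz, Complex.arg_conj, if_neg harg]; ring

/-! ### §2 The `k`-th wedge -/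

/-- The bisector angle `ν_k = -2kπ/g` of the `k`-th (clockwise) wedge. [folklore] -/
def νk (g k : ℕ) : ℝ := -(2 * k * π / g)

variable (g) in
/-- **The `k`-th wedge** of the flower domain: angles in `[ν_k - π/g, ν_k + π/g]` (measured in the
frame centred at `ν_k`). [folklore] -/
def secW (k : ℕ) : Set (𝔼 2) :=
  {u | flower g u ≤ level g ∧ ang (νk g k) u ∈ Icc (νk g k - π / g) (νk g k + π / g)}

/-- Bookkeeping for the melon decomposition (`νk_zero`). [folklore] -/
theorem νk_zero : νk g 0 = 0 := by simp [νk]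

/-- The `0`-th wedge is the standard wedge. [folklore] -/
theorem secW_zero (g : ℕ) : secW g 0 = wedge g := by
  ext u
  simp only [secW, wedge, νk_zero, zero_sub, zero_add, ang_zero_left, mem_setOf_eq, mem_Icc, abs_le]

/-- `ζ_k = exp(-2ν… )`: the `k`-th root of unity is `exp(-i ν_k)`. [folklore] -/
theorem ζC_eq_exp (k : ℕ) : ζC g k = Circle.exp (-νk g k) := by
  rw [ζC, νk, neg_neg]; congr 1; ring

/-- `π/g < π` for `g ≥ 2`. [folklore] -/
theorem pi_div_lt_pi (hg : 2 ≤ g) : π / g < π := by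
  have hg' : (2 : ℝ) ≤ g := by exact_mod_cast hg
  calc π / g ≤ π / 2 := div_le_div_of_nonneg_left Real.pi_pos.le two_pos hg'
    _ < π := by linarith [Real.pi_pos]

/-- **Rotating by `ζ^k` carries the `k`-th wedge onto the standard wedge.** [folklore] -/
theorem rot_mem_wedge_iff (hg : 2 ≤ g) (k : ℕ) (u : 𝔼 2) : rot (ζC g k) u ∈ wedge g ↔ u ∈ secW g k := by
  have hg1 : 1 ≤ g := by omega
  have hπg := pi_div_lt_pi hg
  by_cases hu : u = 0
  · subst hu
    have h0 : (0 : 𝔼 2) ∈ wedge g := ⟨by rw [flower_zero hg1]; exact (level_pos hg1).le,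
      by rw [map_zero, Complex.arg_zero, abs_zero]; positivity⟩
    simp only [map_zero, h0, true_iff]
    refine ⟨by rw [flower_zero hg1]; exact (level_pos hg1).le, ?_⟩
    rw [ang_zero]; constructor <;> linarith [show 0 < π / g by positivity]
  · have hr : 0 < ‖u‖ := norm_pos_iff.2 hu
    have hwin := ang_mem (νk g k) u
    have hrot : rot (ζC g k) u = pol ‖u‖ (ang (νk g k) u - νk g k) := by
      conv_lhs => rw [← pol_norm_ang (νk g k) u]
      rw [ζC_eq_exp, rot_exp_pol]; ring_nf
    show flower g (rot (ζC g k) u) ≤ level g ∧ |Complex.arg (toC (rot (ζC g k) u))| ≤ π / g ↔ _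
    rw [flower_rot (ζC_pow hg1 k), hrot, arg_toC_pol hr ⟨by linarith [hwin.1], by linarith [hwin.2]⟩, abs_le]
    simp only [secW, mem_setOf_eq, mem_Icc]
    constructor
    · rintro ⟨hq, h1, h2⟩; exact ⟨hq, by linarith, by linarith⟩
    · rintro ⟨hq, h1, h2⟩; exact ⟨hq, by linarith, by linarith⟩

/-- **The `k`-th wedge is the image of the standard wedge under the rotation by `ζ^{-k}`.** [folklore] -/
theorem image_rot_inv_wedge (hg : 2 ≤ g) (k : ℕ) : rot (ζC g k)⁻¹ '' wedge g = secW g k := by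
  ext u
  constructor
  · rintro ⟨v, hv, rfl⟩
    rw [← rot_mem_wedge_iff hg, rot_rot_inv]; exact hv
  · intro hu
    exact ⟨rot (ζC g k) u, (rot_mem_wedge_iff hg k u).2 hu, rot_inv_rot _ _⟩

/-- The `k`-th wedge lies in the flower domain. [folklore] -/
theorem flower_le_of_mem_secW {k : ℕ} {u : 𝔼 2} (hu : u ∈ secW g k) : flower g u ≤ level g := hu.1

/-! ### §3 The fan of the first `m + 1` wedges -/

/-- The standard fan `fanW 0` is the standard wedge. [folklore] -/
theorem fanW_zero (g : ℕ) : fanW g 0 = wedge g := by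
  ext u
  simp only [fanW, wedge, mem_setOf_eq, Nat.cast_zero, mul_zero, zero_add, one_mul]
  rw [show μm g 0 = 0 by simp [μm], ang_zero_left, mem_Icc, abs_le]

/-- Numerology: the interval of the `j`-th wedge lies in the window of the fan frame `μ_m` and in
the window of its own frame (`j ≤ m`, `m + 2 ≤ g`). [folklore] -/
theorem wedge_window (hg : 2 ≤ g) {m j : ℕ} (hm : m + 2 ≤ g) (hj : j ≤ m) :
    μm g m - π < νk g j - π / g ∧ νk g j + π / g ≤ μm g m + π ∧
      νk g j - π / g = -((2 * j + 1) * π / g) ∧ νk g j + π / g = -((2 * (j : ℝ) - 1) * π / g) := by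
  have hg' : (0 : ℝ) < g := by exact_mod_cast (show 0 < g by omega)
  have hm' : (m : ℝ) + 2 ≤ g := by exact_mod_cast hm
  have hj' : (j : ℝ) ≤ m := by exact_mod_cast hj
  have hπ := Real.pi_pos
  have hpg : 0 < π / g := by positivity
  have e1 : νk g j - π / g = -((2 * j + 1) * π / g) := by rw [νk]; field_simp; ring
  have e2 : νk g j + π / g = -((2 * (j : ℝ) - 1) * π / g) := by rw [νk]; field_simp; ring
  refine ⟨?_, ?_, e1, e2⟩
  · rw [e1, μm]
    have : (2 * j + 1) * π / g - m * π / g = (2 * j + 1 - m) * (π / g) := by field_simp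
    have h2 : (2 * j + 1 - m) * (π / g) ≤ (m + 1) * (π / g) := by nlinarith
    have h3 : (m + 1) * (π / g) < π := by
      have hlt : ((m : ℝ) + 1) / g < 1 := by rw [div_lt_one hg']; linarith
      have : ((m : ℝ) + 1) * (π / g) = ((m + 1) / g) * π := by ring
      rw [this]; nlinarith
    linarith
  · rw [e2, μm]
    have : -((2 * (j : ℝ) - 1) * π / g) + m * π / g = (m + 1 - 2 * j) * (π / g) := by field_simp; ring
    have h2 : (m + 1 - 2 * (j : ℝ)) * (π / g) ≤ (m + 1) * (π / g) := by nlinarith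
    have h3 : (m + 1) * (π / g) ≤ π := by
      have hle : ((m : ℝ) + 1) / g ≤ 1 := by rw [div_le_one hg']; linarith
      have : ((m : ℝ) + 1) * (π / g) = ((m + 1) / g) * π := by ring
      rw [this]; nlinarith
    linarith

/-- **Membership in the `j`-th wedge, read in the fan frame** (`u ≠ 0`). [folklore] -/
theorem mem_secW_iff_ang_μm (hg : 2 ≤ g) {m j : ℕ} (hm : m + 2 ≤ g) (hj : j ≤ m) {u : 𝔼 2} (hu : u ≠ 0) :
    u ∈ secW g j ↔ flower g u ≤ level g ∧ ang (μm g m) u ∈ Icc (νk g j - π / g) (νk g j + π / g) := by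
  obtain ⟨h1, h2, -, -⟩ := wedge_window hg hm hj
  have hπg := pi_div_lt_pi hg
  simp only [secW, mem_setOf_eq, mem_Icc]
  constructor
  · rintro ⟨hq, ha, hb⟩
    have heq : ang (μm g m) u = ang (νk g j) u := ang_eq_of_mem hu ⟨by linarith, by linarith⟩
    rw [heq]; exact ⟨hq, ha, hb⟩
  · rintro ⟨hq, ha, hb⟩
    have heq : ang (νk g j) u = ang (μm g m) u := ang_eq_of_mem hu ⟨by linarith, by linarith⟩
    rw [heq]; exact ⟨hq, ha, hb⟩

/-- The origin lies in every wedge. [folklore] -/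
theorem zero_mem_secW (hg : 2 ≤ g) (k : ℕ) : (0 : 𝔼 2) ∈ secW g k := by
  have hg1 : 1 ≤ g := by omega
  refine ⟨by rw [flower_zero hg1]; exact (level_pos hg1).le, ?_⟩
  rw [ang_zero]; constructor <;> linarith [show 0 < π / g by positivity]

/-- The origin lies in every fan. [folklore] -/
theorem zero_mem_fanW (hg : 2 ≤ g) (m : ℕ) : (0 : 𝔼 2) ∈ fanW g m := by
  have hg1 : 1 ≤ g := by omega
  have hg' : (0 : ℝ) < g := by exact_mod_cast (show 0 < g by omega)
  refine ⟨by rw [flower_zero hg1]; exact (level_pos hg1).le, ?_⟩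
  rw [ang_zero, μm]
  constructor
  · have : m * π / g ≤ (2 * m + 1) * π / g := by
      rw [div_le_div_iff_of_pos_right hg']; nlinarith [Real.pi_pos]
    linarith
  · have : 0 ≤ m * π / g := by positivity
    have : 0 < π / g := by positivity
    linarith

/-- **The fan is the union of its wedges**: `⋃_{j ≤ m} W_j = fanW m` (`m + 2 ≤ g`). [folklore] -/
theorem iUnion_secW_eq_fanW (hg : 2 ≤ g) {m : ℕ} (hm : m + 2 ≤ g) : ⋃ j ≤ m, secW g j = fanW g m := by
  have hg' : (0 : ℝ) < g := by exact_mod_cast (show 0 < g by omega)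
  have hπ := Real.pi_pos
  have hpg : 0 < π / g := by positivity
  ext u
  simp only [mem_iUnion, exists_prop]
  by_cases hu : u = 0
  · subst hu
    exact ⟨fun _ => zero_mem_fanW hg m, fun _ => ⟨0, Nat.zero_le _, zero_mem_secW hg 0⟩⟩
  constructor
  · rintro ⟨j, hj, hju⟩
    obtain ⟨hq, ha, hb⟩ := (mem_secW_iff_ang_μm hg hm hj hu).1 hju
    obtain ⟨-, -, e1, e2⟩ := wedge_window hg hm hj
    have hj' : (j : ℝ) ≤ m := by exact_mod_cast hj
    refine ⟨hq, ?_, ?_⟩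
    · rw [e1] at ha
      have : (2 * j + 1) * π / g ≤ (2 * m + 1) * π / g := by
        rw [div_le_div_iff_of_pos_right hg']; nlinarith
      linarith
    · rw [e2] at hb
      have h0 : 0 ≤ 2 * (j : ℝ) * π / g := by positivity
      have e : π / g + (2 * (j : ℝ) - 1) * π / g = 2 * j * π / g := by ring
      linarith
  · rintro ⟨hq, ha, hb⟩
    -- choose the wedge: `x = (π/g - φ) / (2π/g) ∈ [0, m + 1]`, `j = min m ⌊x⌋`
    set φ := ang (μm g m) u with hφ
    set x : ℝ := (π / g - φ) / (2 * π / g) with hx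
    have h2pg : 0 < 2 * π / g := by positivity
    have hx0 : 0 ≤ x := div_nonneg (by linarith) h2pg.le
    have hx1 : x ≤ m + 1 := by
      rw [hx, div_le_iff₀ h2pg]
      have : (m + 1 : ℝ) * (2 * π / g) = (2 * m + 1) * π / g + π / g := by field_simp; ring
      linarith
    set j := min m ⌊x⌋₊ with hjdef
    have hjm : j ≤ m := min_le_left _ _
    refine ⟨j, hjm, (mem_secW_iff_ang_μm hg hm hjm hu).2 ⟨hq, ?_⟩⟩
    obtain ⟨-, -, e1, e2⟩ := wedge_window hg hm hjm
    -- `j ≤ x ≤ j + 1`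
    have hjx : (j : ℝ) ≤ x := le_trans (by exact_mod_cast min_le_right _ _) (Nat.floor_le hx0)
    have hxj : x ≤ j + 1 := by
      rcases le_total m ⌊x⌋₊ with h | h
      · rw [hjdef, min_eq_left h]; linarith
      · rw [hjdef, min_eq_right h]; exact (Nat.lt_floor_add_one x).le
    have key : π / g - φ = x * (2 * π / g) := by rw [hx, div_mul_cancel₀ _ h2pg.ne']
    rw [e1, e2]
    constructor
    · -- `φ ≥ -(2j+1)π/g ⟺ π/g - φ ≤ (j+1) 2π/g`
      have : x * (2 * π / g) ≤ (j + 1) * (2 * π / g) := by nlinarith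
      have e : ((j : ℝ) + 1) * (2 * π / g) = (2 * j + 1) * π / g + π / g := by field_simp; ring
      linarith
    · have : (j : ℝ) * (2 * π / g) ≤ x * (2 * π / g) := by nlinarith
      have e : (j : ℝ) * (2 * π / g) = π / g + (2 * (j : ℝ) - 1) * π / g := by field_simp; ring
      linarith

/-! ### §4 The edge rays -/

variable (g) in
/-- **The `k`-th edge ray segment** `{pol r ((1 - 2k)π/g) : 0 ≤ r ≤ ρ₄}` (the upper edge of the
`k`-th wedge; `k = 0`: the standard valley ray). [folklore] -/
def rayK (hg : 2 ≤ g) (k : ℕ) : Set (𝔼 2) := (fun r => pol r ((1 - 2 * (k : ℝ)) * π / g)) '' Icc 0 (rho4 hg)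

/-- The `0`-th edge ray is the standard valley ray. [folklore] -/
theorem rayK_zero (hg : 2 ≤ g) : rayK g hg 0 = vRay g hg := by
  simp only [rayK, vRay, Nat.cast_zero, mul_zero, sub_zero, one_mul]

/-- **The `k`-th edge ray is the rotated standard ray.** [folklore] -/
theorem image_rot_inv_vRay (hg : 2 ≤ g) (k : ℕ) : rot (ζC g k)⁻¹ '' vRay g hg = rayK g hg k := by
  have hinv : (ζC g k)⁻¹ = Circle.exp (νk g k) := by rw [ζC_eq_exp, ← Circle.exp_neg, neg_neg]
  ext u
  simp only [vRay, rayK, mem_image, exists_exists_and_eq_and]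
  constructor
  · rintro ⟨r, hr, rfl⟩
    refine ⟨r, hr, ?_⟩
    rw [hinv, rot_exp_pol, νk]; congr 1; field_simp; ring
  · rintro ⟨r, hr, rfl⟩
    refine ⟨r, hr, ?_⟩
    rw [hinv, rot_exp_pol, νk]; congr 1; field_simp; ring

/-- **The reflected standard ray is the first edge ray** (`θ = -π/g`). [folklore] -/
theorem image_refl_vRay (hg : 2 ≤ g) : refl '' vRay g hg = rayK g hg 1 := by
  ext u
  simp only [vRay, rayK, mem_image, exists_exists_and_eq_and, Nat.cast_one]
  constructor
  · rintro ⟨r, hr, rfl⟩; exact ⟨r, hr, by rw [refl_pol]; congr 1; ring⟩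
  · rintro ⟨r, hr, rfl⟩; exact ⟨r, hr, by rw [refl_pol]; congr 1; ring⟩

/-- The inverse root of unity as an exponential. [folklore] -/
theorem ζC_inv_eq_exp (k : ℕ) : (ζC g k)⁻¹ = Circle.exp (νk g k) := by
  rw [ζC_eq_exp, ← Circle.exp_neg, neg_neg]

/-- `(ζ^k)⁻¹` is a `g`-th root of unity. [folklore] -/
theorem ζC_inv_pow (hg : 1 ≤ g) (k : ℕ) : (((ζC g k)⁻¹ : Circle) : ℂ) ^ g = 1 := by
  rw [Circle.coe_inv, inv_pow, ζC_pow hg k, inv_one]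

/-- **An edge ray lies in its wedge** (as the upper edge). [folklore] -/
theorem rayK_subset_secW (hg : 2 ≤ g) (k : ℕ) : rayK g hg k ⊆ secW g k := by
  have hg1 : 1 ≤ g := by omega
  have hg0 : (0:ℝ) < g := by exact_mod_cast (show 0 < g by omega)
  have hpg : 0 < π / g := by positivity
  rintro _ ⟨r, hr, rfl⟩
  have hθ : (1 - 2 * (k : ℝ)) * π / g = νk g k + π / g := by rw [νk]; ring
  show pol r ((1 - 2 * (k : ℝ)) * π / g) ∈ secW g k
  rw [hθ]
  rcases hr.1.eq_or_lt with h | h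
  · rw [← h, pol_zero_left]; exact zero_mem_secW hg k
  · refine ⟨?_, ?_⟩
    · have e : pol r (νk g k + π / g) = rot (ζC g k)⁻¹ (pol r (π / g)) := by
        rw [ζC_inv_eq_exp, rot_exp_pol]; congr 1; ring
      rw [e, flower_rot (ζC_inv_pow hg1 k), flower_pol_valley hg1]
      exact (vprof_le_level_iff hg hr.1).2 hr.2
    · rw [ang_pol h ⟨by rw [add_sub_cancel_left]; linarith [Real.pi_pos], by rw [add_sub_cancel_left]; linarith [pi_div_lt_pi hg]⟩]
      exact ⟨by linarith, le_rfl⟩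

/-- **The next edge ray lies in the wedge too** (as the lower edge). [folklore] -/
theorem rayK_succ_subset_secW (hg : 2 ≤ g) (k : ℕ) : rayK g hg (k + 1) ⊆ secW g k := by
  have hg1 : 1 ≤ g := by omega
  have hg0 : (0:ℝ) < g := by exact_mod_cast (show 0 < g by omega)
  have hpg : 0 < π / g := by positivity
  rintro _ ⟨r, hr, rfl⟩
  have hθ : (1 - 2 * ((k + 1 : ℕ) : ℝ)) * π / g = νk g k - π / g := by push_cast; rw [νk]; ring
  show pol r ((1 - 2 * ((k + 1 : ℕ) : ℝ)) * π / g) ∈ secW g k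
  rw [hθ]
  rcases hr.1.eq_or_lt with h | h
  · rw [← h, pol_zero_left]; exact zero_mem_secW hg k
  · refine ⟨?_, ?_⟩
    · have e : pol r (νk g k - π / g) = rot (ζC g (k + 1))⁻¹ (pol r (π / g)) := by
        rw [ζC_inv_eq_exp, rot_exp_pol, νk, νk]; congr 1; push_cast; ring
      rw [e, flower_rot (ζC_inv_pow hg1 (k + 1)), flower_pol_valley hg1]
      exact (vprof_le_level_iff hg hr.1).2 hr.2
    · rw [ang_pol h ⟨by rw [sub_sub_cancel_left]; linarith [pi_div_lt_pi hg], by rw [sub_sub_cancel_left]; linarith [Real.pi_pos]⟩]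
      exact ⟨le_rfl, by linarith⟩

/-- **Norm along an edge ray.** [folklore] -/
theorem norm_of_mem_rayK (hg : 2 ≤ g) {k : ℕ} {u : 𝔼 2} (hu : u ∈ rayK g hg k) : ‖u‖ ≤ rho4 hg := by
  obtain ⟨r, hr, rfl⟩ := hu
  rw [norm_pol, abs_of_nonneg hr.1]; exact hr.2

/-- A point of the flower domain with prescribed angle in the frame `μ` lies on the corresponding
edge ray (when that angle is an edge angle). [folklore] -/
theorem mem_rayK_of_ang_eq (hg : 2 ≤ g) {μ : ℝ} {u : 𝔼 2} (hq : flower g u ≤ level g) (k : ℕ) {θ : ℝ}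
    (hθ : θ = (1 - 2 * (k : ℝ)) * π / g ∨ θ = (1 - 2 * (k : ℝ)) * π / g + 2 * π ∨ θ = (1 - 2 * (k : ℝ)) * π / g - 2 * π)
    (hang : ang μ u = θ) : u ∈ rayK g hg k := by
  refine ⟨‖u‖, ⟨norm_nonneg _, norm_le_rho4_of_flower_le hg hq⟩, ?_⟩
  show pol ‖u‖ ((1 - 2 * (k : ℝ)) * π / g) = u
  conv_rhs => rw [← pol_norm_ang μ u, hang]
  rcases hθ with h | h | h
  · rw [h]
  · rw [h, pol_add_two_pi]
  · rw [h]
    conv_lhs => rw [← sub_add_cancel ((1 - 2 * (k : ℝ)) * π / g) (2 * π), pol_add_two_pi]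

/-! ### §5 The symmetry of a fan swapping its edges -/

/-- `ν_m = 2 μ_m`. [folklore] -/
theorem νk_eq_two_mul_μm (m : ℕ) : νk g m = 2 * μm g m := by rw [νk, μm]; ring

/-- **The angle of the mirrored point**: the symmetry `σ_m = rot ζ^{-m} ∘ refl` of the fan acts on
fan angles by `θ ↦ 2μ_m - θ`. [folklore] -/
theorem ang_fanSymm (hg : 2 ≤ g) {m : ℕ} (hm : m + 2 ≤ g) {u : 𝔼 2} (hu : u ∈ fanW g m) :
    ang (μm g m) (rot (ζC g m)⁻¹ (refl u)) = 2 * μm g m - ang (μm g m) u := by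
  obtain ⟨-, h2, h3, -⟩ := fan_window hg hm
  have hne : ang (μm g m) u ≠ μm g m + π := by
    intro h; have := hu.2.2; rw [h] at this; linarith
  have hrot := ang_rot (-μm g m) (2 * μm g m) (refl u)
  rw [show -μm g m + 2 * μm g m = μm g m by ring] at hrot
  rw [ζC_inv_eq_exp, νk_eq_two_mul_μm, hrot, ang_refl hne]; ring

/-- The symmetry preserves the fan. [folklore] -/
theorem fanSymm_mem_fanW (hg : 2 ≤ g) {m : ℕ} (hm : m + 2 ≤ g) {u : 𝔼 2} (hu : u ∈ fanW g m) :
    rot (ζC g m)⁻¹ (refl u) ∈ fanW g m := by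
  have hg1 : 1 ≤ g := by omega
  refine ⟨by rw [flower_rot (ζC_inv_pow hg1 m), flower_refl]; exact hu.1, ?_⟩
  rw [ang_fanSymm hg hm hu]
  obtain ⟨ha, hb⟩ := hu.2
  have e : 2 * μm g m = -((2 * m + 1) * π / g) + π / g := by rw [μm]; ring
  constructor <;> linarith

/-- The symmetry is an involution. [folklore] -/
theorem fanSymm_fanSymm (m : ℕ) (u : 𝔼 2) : rot (ζC g m)⁻¹ (refl (rot (ζC g m)⁻¹ (refl u))) = u := by
  rw [refl_rot, inv_inv, refl_refl, rot_inv_rot]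

/-- **The symmetry maps the fan onto itself.** [folklore] -/
theorem image_fanSymm_fanW (hg : 2 ≤ g) {m : ℕ} (hm : m + 2 ≤ g) :
    (fun u => rot (ζC g m)⁻¹ (refl u)) '' fanW g m = fanW g m := by
  refine Subset.antisymm ?_ fun u hu => ⟨_, fanSymm_mem_fanW hg hm hu, fanSymm_fanSymm m u⟩
  rintro _ ⟨u, hu, rfl⟩; exact fanSymm_mem_fanW hg hm hu

/-- **The symmetry maps the standard ray onto the lower edge ray** of the fan. [folklore] -/
theorem image_fanSymm_vRay (hg : 2 ≤ g) (m : ℕ) :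
    (fun u => rot (ζC g m)⁻¹ (refl u)) '' vRay g hg = rayK g hg (m + 1) := by
  ext u
  simp only [vRay, rayK, mem_image, exists_exists_and_eq_and]
  have key : ∀ r : ℝ, rot (ζC g m)⁻¹ (refl (pol r (π / g))) = pol r ((1 - 2 * ((m + 1 : ℕ) : ℝ)) * π / g) := by
    intro r
    rw [refl_pol, ζC_inv_eq_exp, rot_exp_pol, νk]; congr 1; push_cast; ring
  constructor
  · rintro ⟨r, hr, rfl⟩; exact ⟨r, hr, (key r).symm⟩
  · rintro ⟨r, hr, rfl⟩; exact ⟨r, hr, key r⟩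

/-! ### §6 The last sector and the last gluing circle (`g = n + 2`) -/

/-- `ζ^g = 1` in the circle group. [folklore] -/
theorem ζC_self (hg : 1 ≤ g) : ζC g g = 1 := by
  have hg' : (g : ℝ) ≠ 0 := by exact_mod_cast (show g ≠ 0 by omega)
  rw [ζC, mul_div_assoc, div_self hg', mul_one, Circle.exp_two_pi]

/-- **The last wedge is the two-edged fan with one sector**: `W_{n+1} = fanF 1` (`g = n + 2`). [folklore] -/
theorem secW_last_eq_fanF {n : ℕ} (hg : 2 ≤ n + 2) : secW (n + 2) (n + 1) = fanF (n + 2) 1 := by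
  have hg' : (0 : ℝ) < (n + 2 : ℕ) := by exact_mod_cast (show 0 < n + 2 by omega)
  have hν : νk (n + 2) (n + 1) = μk (n + 2) 1 - 2 * π := by
    rw [νk, μk]; push_cast; field_simp; ring
  ext u
  simp only [secW, fanF, mem_setOf_eq, mem_Icc, hν, ang_sub_two_pi]
  have e1 : μk (n + 2) 1 - 2 * π - π / (n + 2 : ℕ) = π / (n + 2 : ℕ) - 2 * π := by rw [μk]; push_cast; field_simp; ring
  have e2 : μk (n + 2) 1 - 2 * π + π / (n + 2 : ℕ) = (2 * (1 : ℕ) + 1) * π / (n + 2 : ℕ) - 2 * π := by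
    rw [μk]; push_cast; field_simp; ring
  rw [e1, e2]
  constructor
  · rintro ⟨hq, ha, hb⟩; exact ⟨hq, by linarith, by linarith⟩
  · rintro ⟨hq, ha, hb⟩; exact ⟨hq, by linarith, by linarith⟩

/-- **The two edge rays of the last wedge**: `vRay2 1 = ray(π/g) ∪ ray(3π/g) = rayK 0 ∪ rayK (n+1)`. [folklore] -/
theorem vRay2_one_eq {n : ℕ} (hg : 2 ≤ n + 2) : vRay2 (n + 2) 1 hg = rayK (n + 2) hg 0 ∪ rayK (n + 2) hg (n + 1) := by
  rw [vRay2, rayK_zero]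
  congr 1
  ext u
  simp only [vRay, rayK, bisRefl, mem_image, exists_exists_and_eq_and]
  have key : ∀ r : ℝ, rot (ζC (n + 2) (1 + 1)) (refl (pol r (π / (n + 2 : ℕ)))) =
      pol r ((1 - 2 * ((n + 1 : ℕ) : ℝ)) * π / (n + 2 : ℕ)) := by
    intro r
    rw [refl_pol, ζC, rot_exp_pol]
    conv_rhs => rw [← pol_add_two_pi]
    congr 1; push_cast; field_simp; ring
  constructor
  · rintro ⟨r, hr, rfl⟩; exact ⟨r, hr, (key r).symm⟩
  · rintro ⟨r, hr, rfl⟩; exact ⟨r, hr, key r⟩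

/-- **Rotating the complementary two-edged fan onto the fan of the first `n + 1` wedges**:
`rot ζ (fanF (g-1)) = fanW (g-2)` (`g = n + 2`). [folklore] -/
theorem image_rot_fanF_last {n : ℕ} (hg : 2 ≤ n + 2) : rot (ζC (n + 2) 1) '' fanF (n + 2) (n + 1) = fanW (n + 2) n := by
  have hg1 : 1 ≤ n + 2 := by omega
  set p : ℝ := π / (n + 2 : ℕ) with hp
  have hp0 : 0 < p := by positivity
  have eμ : μm (n + 2) n = -(n * p) := by rw [μm, hp]; ring
  have eν1 : νk (n + 2) 1 = -(2 * p) := by rw [νk, hp]; push_cast; ring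
  have eμk : μk (n + 2) (n + 1) = (n + 2) * p := by rw [μk, hp]; push_cast; ring
  have e2π : 2 * π = (2 * n + 4) * p := by
    rw [hp]; have : ((n + 2 : ℕ) : ℝ) ≠ 0 := by positivity
    field_simp; push_cast; ring
  have eup : (2 * ((n + 1 : ℕ) : ℝ) + 1) * π / (n + 2 : ℕ) = (2 * n + 3) * p := by rw [hp]; push_cast; ring
  have elo : -((2 * (n : ℝ) + 1) * π / (n + 2 : ℕ)) = -((2 * n + 1) * p) := by rw [hp]; ring
  have hframe : μm (n + 2) n + 2 * π + νk (n + 2) 1 = μk (n + 2) (n + 1) := by rw [eμ, eν1, eμk, e2π]; ring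
  -- `ang μk u = ang μ_n (rot ζ u) + 2π + ν₁` for every `u`
  have hrel : ∀ u : 𝔼 2, ang (μk (n + 2) (n + 1)) u = ang (μm (n + 2) n) (rot (ζC (n + 2) 1) u) + 2 * π + νk (n + 2) 1 := by
    intro u
    have h := ang_rot (μm (n + 2) n + 2 * π) (νk (n + 2) 1) (rot (ζC (n + 2) 1) u)
    rw [← ζC_inv_eq_exp, rot_inv_rot, hframe, ang_add_two_pi] at h
    exact h
  ext v
  constructor
  · rintro ⟨u, hu, rfl⟩
    refine ⟨by rw [flower_rot (ζC_pow hg1 1)]; exact hu.1, ?_⟩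
    obtain ⟨ha, hb⟩ := hu.2
    rw [hrel u, eup, e2π, eν1] at *
    rw [mem_Icc, elo]
    constructor <;> linarith
  · intro hv
    refine ⟨rot (ζC (n + 2) 1)⁻¹ v, ⟨by rw [flower_rot (ζC_inv_pow hg1 1)]; exact hv.1, ?_⟩, rot_rot_inv _ _⟩
    obtain ⟨ha, hb⟩ := hv.2
    rw [elo] at ha
    rw [mem_Icc, hrel, rot_rot_inv, eup, e2π, eν1]
    constructor <;> linarith

/-- **Rotating the two edge rays of the complementary fan**: `rot ζ (vRay2 (g-1)) = ray(3π/g) ∪ ray(π/g)`. [folklore] -/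
theorem image_rot_vRay2_last {n : ℕ} (hg : 2 ≤ n + 2) :
    rot (ζC (n + 2) 1) '' vRay2 (n + 2) (n + 1) hg = rayK (n + 2) hg (n + 1) ∪ rayK (n + 2) hg 0 := by
  have hg1 : 1 ≤ n + 2 := by omega
  have hg' : (0 : ℝ) < (n + 2 : ℕ) := by exact_mod_cast (show 0 < n + 2 by omega)
  rw [vRay2, image_union]
  congr 1
  · ext u
    simp only [vRay, rayK, mem_image, exists_exists_and_eq_and]
    have key : ∀ r : ℝ, rot (ζC (n + 2) 1) (pol r (π / (n + 2 : ℕ))) = pol r ((1 - 2 * ((n + 1 : ℕ) : ℝ)) * π / (n + 2 : ℕ)) := by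
      intro r
      rw [ζC, rot_exp_pol]
      conv_rhs => rw [← pol_add_two_pi]
      congr 1; push_cast; field_simp; ring
    constructor
    · rintro ⟨r, hr, rfl⟩; exact ⟨r, hr, (key r).symm⟩
    · rintro ⟨r, hr, rfl⟩; exact ⟨r, hr, key r⟩
  · ext u
    simp only [vRay, rayK, bisRefl, mem_image, exists_exists_and_eq_and, Nat.cast_zero, mul_zero, sub_zero, one_mul]
    have hζ : ζC (n + 2) (n + 1 + 1) = 1 := ζC_self hg1
    have key : ∀ r : ℝ, rot (ζC (n + 2) 1) (rot (ζC (n + 2) (n + 1 + 1)) (refl (pol r (π / (n + 2 : ℕ))))) = pol r (π / (n + 2 : ℕ)) := by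
      intro r
      rw [hζ, rot_one, refl_pol, ζC, rot_exp_pol]; congr 1; push_cast; field_simp; ring
    constructor
    · rintro ⟨r, hr, rfl⟩; exact ⟨r, hr, (key r).symm⟩
    · rintro ⟨r, hr, rfl⟩; exact ⟨r, hr, key r⟩

/-! ### §7 How consecutive pieces meet -/

/-- **A fan meets the next wedge in the common edge ray** (`1 ≤ k`, `k + 2 ≤ g`). [folklore] -/
theorem fanW_inter_secW_subset (hg : 2 ≤ g) {k : ℕ} (hk : 1 ≤ k) (hkg : k + 2 ≤ g) :
    fanW g (k - 1) ∩ secW g k ⊆ rayK g hg k := by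
  have hg' : (0 : ℝ) < g := by exact_mod_cast (show 0 < g by omega)
  rintro u ⟨hu1, hu2⟩
  by_cases hu : u = 0
  · subst hu; exact ⟨0, ⟨le_rfl, (rho4_pos hg).le⟩, pol_zero_left _⟩
  -- read both memberships in the frame `μ_k`
  rw [← iUnion_secW_eq_fanW hg (by omega : (k - 1) + 2 ≤ g)] at hu1
  simp only [mem_iUnion, exists_prop] at hu1
  obtain ⟨j, hj, hju⟩ := hu1
  obtain ⟨hq, ha, hb⟩ := (mem_secW_iff_ang_μm hg hkg (by omega : j ≤ k) hu).1 hju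
  obtain ⟨-, ha', hb'⟩ := (mem_secW_iff_ang_μm hg hkg le_rfl hu).1 hu2
  obtain ⟨-, -, e1, e2⟩ := wedge_window hg hkg (by omega : j ≤ k)
  obtain ⟨-, -, e1', e2'⟩ := wedge_window hg hkg (le_refl k)
  rw [e1] at ha; rw [e2] at hb; rw [e1'] at ha'; rw [e2'] at hb'
  -- `ang μ_k u = (1 - 2k) π / g`
  have hkr : (1 : ℝ) ≤ k := by exact_mod_cast hk
  have hjk : (j : ℝ) ≤ k - 1 := by
    have : j ≤ k - 1 := by omega
    have hk1 : ((k - 1 : ℕ) : ℝ) = k - 1 := by push_cast [Nat.cast_sub hk]; ring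
    rw [← hk1]; exact_mod_cast this
  have hup : ang (μm g k) u ≤ -((2 * (k : ℝ) - 1) * π / g) := hb'
  have hlo : -((2 * (j : ℝ) + 1) * π / g) ≤ ang (μm g k) u := ha
  have hcmp : -((2 * (k : ℝ) - 1) * π / g) ≤ -((2 * (j : ℝ) + 1) * π / g) := by
    rw [neg_le_neg_iff, div_le_div_iff_of_pos_right hg']; nlinarith [Real.pi_pos]
  have heq : ang (μm g k) u = (1 - 2 * (k : ℝ)) * π / g := by
    have : (1 - 2 * (k : ℝ)) * π / g = -((2 * (k : ℝ) - 1) * π / g) := by ring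
    rw [this]; linarith
  exact mem_rayK_of_ang_eq hg hq k (Or.inl rfl) heq

/-- **The fan of the first `n + 1` wedges meets the last wedge in the two edge rays**
(`g = n + 2`). [folklore] -/
theorem fanW_inter_secW_last_subset {n : ℕ} (hg : 2 ≤ n + 2) :
    fanW (n + 2) n ∩ secW (n + 2) (n + 1) ⊆ rayK (n + 2) hg (n + 1) ∪ rayK (n + 2) hg 0 := by
  have hπ := Real.pi_pos
  set p : ℝ := π / (n + 2 : ℕ) with hp
  have hp0 : 0 < p := by positivity
  have eμ : μm (n + 2) n = -(n * p) := by rw [μm, hp]; ring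
  have eν : νk (n + 2) (n + 1) = -(2 * (n + 1) * p) := by rw [νk, hp]; push_cast; ring
  have e2π : 2 * π = (2 * n + 4) * p := by
    rw [hp]; have : ((n + 2 : ℕ) : ℝ) ≠ 0 := by positivity
    field_simp; push_cast; ring
  have eπ : π = (n + 2) * p := by linarith
  have elo : -((2 * (n : ℝ) + 1) * π / (n + 2 : ℕ)) = -((2 * n + 1) * p) := by rw [hp]; ring
  have eray1 : (1 - 2 * ((n + 1 : ℕ) : ℝ)) * π / (n + 2 : ℕ) = -((2 * n + 1) * p) := by rw [hp]; push_cast; ring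
  have eray0 : (1 - 2 * ((0 : ℕ) : ℝ)) * π / (n + 2 : ℕ) = p := by rw [hp]; simp
  rintro u ⟨hu1, hu2⟩
  by_cases hu : u = 0
  · subst hu; exact Or.inl ⟨0, ⟨le_rfl, (rho4_pos hg).le⟩, pol_zero_left _⟩
  obtain ⟨hq, ha, hb⟩ := hu1
  obtain ⟨-, ha', hb'⟩ := hu2
  rw [elo] at ha
  have hn0 : (0 : ℝ) ≤ n := by positivity
  rcases lt_or_ge (μm (n + 2) n - π) (ang (νk (n + 2) (n + 1)) u) with h | h
  · -- the angle of the last wedge lies in the window of `μ_n`: the angles agree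
    have heq : ang (μm (n + 2) n) u = ang (νk (n + 2) (n + 1)) u := by
      refine ang_eq_of_mem hu ⟨by linarith, ?_⟩
      rw [eμ, eπ]; nlinarith
    have hval : ang (μm (n + 2) n) u = (1 - 2 * ((n + 1 : ℕ) : ℝ)) * π / (n + 2 : ℕ) := by
      rw [eray1]; apply le_antisymm
      · rw [heq]; linarith
      · exact ha
    exact Or.inl (mem_rayK_of_ang_eq hg hq (n + 1) (Or.inl rfl) hval)
  · -- below the window: shift by `2π`
    rw [eμ, eπ] at h
    have hψ2 : ang (νk (n + 2) (n + 1) + 2 * π) u = ang (νk (n + 2) (n + 1)) u + 2 * π := ang_add_two_pi _ _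
    have heq : ang (μm (n + 2) n) u = ang (νk (n + 2) (n + 1)) u + 2 * π := by
      rw [← hψ2]
      refine ang_eq_of_mem hu ⟨?_, ?_⟩
      · rw [hψ2, eμ, e2π, eπ]; nlinarith
      · rw [hψ2, eμ, e2π, eπ]; nlinarith
    have hval : ang (μm (n + 2) n) u = (1 - 2 * ((0 : ℕ) : ℝ)) * π / (n + 2 : ℕ) := by
      rw [eray0]; apply le_antisymm hb
      rw [heq, e2π]; nlinarith
    exact Or.inr (mem_rayK_of_ang_eq hg hq 0 (Or.inl rfl) hval)

/-! ### §8 The wedges cover the flower domain -/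

/-- **The flower domain is covered by the fan of the first `n + 1` wedges and the last wedge**
(`g = n + 2`). [folklore] -/
theorem flowerDomain_subset_fanW_union_secW {n : ℕ} (hg : 2 ≤ n + 2) {u : 𝔼 2} (hq : flower (n + 2) u ≤ level (n + 2)) :
    u ∈ fanW (n + 2) n ∪ secW (n + 2) (n + 1) := by
  have hπ := Real.pi_pos
  set p : ℝ := π / (n + 2 : ℕ) with hp
  have hp0 : 0 < p := by positivity
  have eμ : μm (n + 2) n = -(n * p) := by rw [μm, hp]; ring
  have eν : νk (n + 2) (n + 1) = -(2 * (n + 1) * p) := by rw [νk, hp]; push_cast; ring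
  have e2π : 2 * π = (2 * n + 4) * p := by
    rw [hp]; have : ((n + 2 : ℕ) : ℝ) ≠ 0 := by positivity
    field_simp; push_cast; ring
  have eπ : π = (n + 2) * p := by linarith
  have elo : -((2 * (n : ℝ) + 1) * π / (n + 2 : ℕ)) = -((2 * n + 1) * p) := by rw [hp]; ring
  have hn0 : (0 : ℝ) ≤ n := by positivity
  by_cases hu : u = 0
  · subst hu; exact Or.inl (zero_mem_fanW hg n)
  obtain ⟨hw1, hw2⟩ := ang_mem (μm (n + 2) n) u
  by_cases h1 : ang (μm (n + 2) n) u ∈ Icc (-((2 * (n : ℝ) + 1) * π / (n + 2 : ℕ))) (π / (n + 2 : ℕ))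
  · exact Or.inl ⟨hq, h1⟩
  right
  refine ⟨hq, ?_⟩
  rw [mem_Icc, elo, not_and_or, not_le, not_le] at h1
  rcases h1 with h1 | h1
  · -- `φ < -(2n+1)p`: the angle in the last frame is `φ`
    have heq : ang (νk (n + 2) (n + 1)) u = ang (μm (n + 2) n) u :=
      ang_eq_of_mem hu ⟨by rw [eν]; nlinarith [hw1], by rw [eν, eπ]; nlinarith [hw1]⟩
    rw [heq, eν, mem_Icc]
    constructor <;> nlinarith [hw1]
  · -- `φ > p`: the angle in the last frame is `φ - 2π`
    have hs := ang_sub_two_pi (μm (n + 2) n) u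
    have heq : ang (νk (n + 2) (n + 1)) u = ang (μm (n + 2) n) u - 2 * π := by
      rw [← hs]
      refine ang_eq_of_mem hu ⟨?_, ?_⟩
      · rw [hs, eν, e2π, eπ]; nlinarith [hw2]
      · rw [hs, eν, e2π, eπ]; nlinarith [hw2]
    rw [heq, eν, e2π, mem_Icc]
    constructor <;> nlinarith [hw2]

end FlowerModel

end Literature.Topology.FourManifolds
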